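import Mathlib
import Summits.QuantumFields.YangMills.Theorems.TransportFieldFanoOneLinkHarnack
import Summits.QuantumFields.YangMills.Theorems.TransportFieldPolyakovLineSurgery
import Summits.QuantumFields.YangMills.Theorems.LuscherReductionTwistedTraceScalingToronOrbit
import HarnessLib

/-!
# The torelon floor of the exact zero-flux vacuum: `E_{Ω²}[4 − (Re tr P₀(x))²] ≥ e^{−15}/β²` for `β ≥ 1`, EVERY `L`, every site
# (route `TransportFieldFano`, LINE g17-A, crux ⟨stmt-QuantumFields-23362⟩ helper lane — the residual of ✓`dWeightedPlaquetteMean_of_logFloor`)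

Sequel to ✓`…TransportFieldFanoOneLinkHarnack` (★★ `vacuum_sq_linkShift_ge`: `Ω(U[e ↦ U_e g])² ≥ e^{−14√2β‖g−1‖_F}Ω(U)²`).  The torelon
deviation `d_x = 4 − (Re tr P₀(x))²` of the Polyakov word through the link `e = (x − ê₀, 0)` becomes `4 − (Re tr P·g)²` after the right shift
`U_e ↦ U_e g` (✓`TransportField.trace_su2Rep_lineHolonomy_online`, `k = 0`); for the diagonal pair `g = diag(e^{±iθ})` the two shifted
deviations add up to at least `8 sin²θ` whatever `P ∈ SU(2)` is (`|P₀₀|, |P₁₁| ≤ 1`, `sin²θ ≤ cos²θ`); fibrewise right-Haar invariance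
(✓`TransportField.integral_configMeasure_comp_update_mul_right`) and the one-link Harnack inequality then give, with `θ = 1/(2β)`,
* ★★★ `torelonDev_vacuum_mean_ge` — `∫ d_x·Ω² dU ≥ e^{−15}/β²` for every `l2`-normalised physical `Ω` with `K_βΩ = λ₀Ω`, `β ≥ 1`, every `L`, `x`;
* ★★★ `torelon_logFloor` — the hypothesis `hfloor` of ✓`dWeightedPlaquetteMean_of_logFloor` with `k₀ = 0`, `C₀ = 15 + 2/ε`, `β₁ = 1`
  (`E[FΩ²] = E[d_0Ω²]` by ✓`l2_flowLiftAt_mul_vacuum_eq_flowLift`; `log β ≤ β^ε/ε`).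
So the torelon mean is polynomially (not exponentially) small at worst — by one-link ULTRAVIOLET spread, with no zero-mode input.
HONEST FRAMING: fixed-lattice helper estimates (`--supports 23362`); the registered stub is closed by name in the sequel file; no rung or
summit statement; nothing about infinite volume, the continuum or the Yang–Mills mass gap.  No `sorry`, no new definition.
References: [cite: ReedSimonIV1978, Thm. XIII.43]; [cite: Luscher1983, §2].
-/

set_option autoImplicit false

noncomputable section

open MeasureTheory Filter Topology Real
open Literature.MathematicalPhysics.QuantumFieldTheory (GaugeConfig Site Edge lineHolonomy wilsonFlow_zero frobNorm frobNorm_nonneg)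
open Literature.MathematicalPhysics.QuantumLattice (fundamentalRep_apply secondCountableTopology_su2)

namespace Summit.QuantumFields.YangMills.Theorems.TransportFieldFano

open Summit.QuantumFields.YangMills.Theorems.FemtoTransferGap
open Summit.QuantumFields.YangMills.Theorems.AdjointLoopFano
open Summit.QuantumFields.YangMills.Theorems.TransportField

variable {L : ℕ} [NeZero L]

/-! ## §1 The diagonal pair `diag(e^{±iθ})` against an arbitrary `P ∈ SU(2)` -/

/-- `Re tr(M·diag(e^{iθ}, e^{−iθ})) = (Re M₀₀ + Re M₁₁) cos θ + (Im M₁₁ − Im M₀₀) sin θ`. [folklore] -/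
theorem re_trace_mul_diagSU2 (M : Matrix (Fin 2) (Fin 2) ℂ) (θ : ℝ) :
    (M * ((diagSU2 θ : SU2) : Matrix (Fin 2) (Fin 2) ℂ)).trace.re =
      ((M 0 0).re + (M 1 1).re) * Real.cos θ + ((M 1 1).im - (M 0 0).im) * Real.sin θ := by
  have hc : (Complex.exp (θ * Complex.I)).re = Real.cos θ := Complex.exp_ofReal_mul_I_re θ
  have hs : (Complex.exp (θ * Complex.I)).im = Real.sin θ := Complex.exp_ofReal_mul_I_im θ
  have hneg : -(θ * Complex.I) = ((-θ : ℝ) : ℂ) * Complex.I := by push_cast; ring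
  have hc' : (Complex.exp (-(θ * Complex.I))).re = Real.cos θ := by rw [hneg, Complex.exp_ofReal_mul_I_re, Real.cos_neg]
  have hs' : (Complex.exp (-(θ * Complex.I))).im = -Real.sin θ := by rw [hneg, Complex.exp_ofReal_mul_I_im, Real.sin_neg]
  rw [TwoLattice.Toron.coe_diagSU2, Matrix.trace_fin_two]
  simp only [Matrix.mul_apply, Fin.sum_univ_two, Matrix.of_apply, Matrix.cons_val', Matrix.cons_val_zero, Matrix.cons_val_one,
    Matrix.empty_val', Matrix.cons_val_fin_one, mul_zero, add_zero, zero_add, Complex.add_re, Complex.mul_re, hc, hs, hc', hs']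
  ring

/-- ★ **The diagonal pair sees every Polyakov loop**: for `P ∈ SU(2)` and `sin²θ ≤ cos²θ`,
`(4 − (Re tr P·diag(e^{iθ}))²) + (4 − (Re tr P·diag(e^{−iθ}))²) ≥ 8 sin²θ`
(the cross terms cancel; `(Re P₀₀ + Re P₁₁)² + (Im P₁₁ − Im P₀₀)² ≤ 4` from `|P₀₀|, |P₁₁| ≤ 1`). [folklore] -/
theorem torelonDev_diag_pair_ge (P : SU2) {θ : ℝ} (hθ : Real.sin θ ^ 2 ≤ Real.cos θ ^ 2) :
    8 * Real.sin θ ^ 2 ≤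
      (4 - ((P : Matrix (Fin 2) (Fin 2) ℂ) * ((diagSU2 θ : SU2) : Matrix (Fin 2) (Fin 2) ℂ)).trace.re ^ 2) +
        (4 - ((P : Matrix (Fin 2) (Fin 2) ℂ) * ((diagSU2 (-θ) : SU2) : Matrix (Fin 2) (Fin 2) ℂ)).trace.re ^ 2) := by
  rw [re_trace_mul_diagSU2, re_trace_mul_diagSU2, Real.cos_neg, Real.sin_neg]
  set a := ((P : Matrix (Fin 2) (Fin 2) ℂ) 0 0).re with ha
  set b := ((P : Matrix (Fin 2) (Fin 2) ℂ) 0 0).im with hb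
  set c := ((P : Matrix (Fin 2) (Fin 2) ℂ) 1 1).re with hc
  set d := ((P : Matrix (Fin 2) (Fin 2) ℂ) 1 1).im with hd
  have h00 : ‖(P : Matrix (Fin 2) (Fin 2) ℂ) 0 0‖ ≤ 1 := entry_norm_bound_of_unitary (su2_mem_unitaryGroup P) 0 0
  have h11 : ‖(P : Matrix (Fin 2) (Fin 2) ℂ) 1 1‖ ≤ 1 := entry_norm_bound_of_unitary (su2_mem_unitaryGroup P) 1 1
  have e00 : ‖(P : Matrix (Fin 2) (Fin 2) ℂ) 0 0‖ ^ 2 = a ^ 2 + b ^ 2 := by rw [Complex.sq_norm, Complex.normSq_apply, ha, hb]; ring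
  have e11 : ‖(P : Matrix (Fin 2) (Fin 2) ℂ) 1 1‖ ^ 2 = c ^ 2 + d ^ 2 := by rw [Complex.sq_norm, Complex.normSq_apply, hc, hd]; ring
  have hab : a ^ 2 + b ^ 2 ≤ 1 := by
    rw [← e00]; exact pow_le_one₀ (norm_nonneg _) h00
  have hcd : c ^ 2 + d ^ 2 ≤ 1 := by
    rw [← e11]; exact pow_le_one₀ (norm_nonneg _) h11
  have hAB : (a + c) ^ 2 + (d - b) ^ 2 ≤ 4 := by nlinarith [sq_nonneg (a - c), sq_nonneg (d + b)]
  have hsc := Real.sin_sq_add_cos_sq θ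
  have h1 : (d - b) ^ 2 * Real.sin θ ^ 2 ≤ (d - b) ^ 2 * Real.cos θ ^ 2 := mul_le_mul_of_nonneg_left hθ (sq_nonneg _)
  have h2 : ((a + c) ^ 2 + (d - b) ^ 2) * Real.cos θ ^ 2 ≤ 4 * Real.cos θ ^ 2 := mul_le_mul_of_nonneg_right hAB (sq_nonneg _)
  nlinarith [h1, h2, hsc]

/-! ## §2 The torelon deviation through a shifted link -/

/-- The torelon deviation at a base point, unfolded: `d_x(U) = 4 − (Re tr ρ(P₀(x)(U)))²`. [folklore] -/
theorem flowLiftAt_torelonDev_eq (x : Site 3 L) (U : GaugeConfig 3 L SU2) :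
    flowLiftAt x 0 (fun u : GaugeConfig 3 1 SU2 => 4 - ((su2Rep (u ((0 : Site 3 1), (0 : Fin 3)))).trace.re) ^ 2) U =
      4 - ((su2Rep (lineHolonomy U 0 L x)).trace.re) ^ 2 := by
  simp only [flowLiftAt, wilsonFlow_zero, polyakovSite]

/-- ★ **Word surgery at the base point**: shifting the last link `e = (x', 0)` of the Polyakov word from `x = x' + ê₀` by `g` on the right
turns `d_x` into `4 − (Re tr ρ(P₀(x))ρ(g))²`. [cite: Luscher1983, §2] -/
theorem flowLiftAt_torelonDev_update (x' : Site 3 L) (U : GaugeConfig 3 L SU2) (g : SU2) :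
    flowLiftAt (x'.shift 0) 0 (fun u : GaugeConfig 3 1 SU2 => 4 - ((su2Rep (u ((0 : Site 3 1), (0 : Fin 3)))).trace.re) ^ 2)
        (Function.update U (x', (0 : Fin 3)) (U (x', (0 : Fin 3)) * g)) =
      4 - ((su2Rep (lineHolonomy U 0 L (x'.shift 0)) * su2Rep g).trace.re) ^ 2 := by
  rw [flowLiftAt_torelonDev_eq]
  have hL : 0 < L := Nat.pos_of_ne_zero (NeZero.ne L)
  have h := trace_su2Rep_lineHolonomy_online U x' g (k := 0) hL
  simp only [Nat.cast_zero, Pi.single_zero, add_zero] at h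
  rw [h]

/-- The shifted deviations are non-negative: `0 ≤ 4 − (Re tr ρ(P)ρ(g))²`. [folklore] -/
theorem torelonDev_mul_nonneg (P g : SU2) : 0 ≤ 4 - ((su2Rep P * su2Rep g).trace.re) ^ 2 := by
  rw [← map_mul]
  have h1 := re_trace_le_two (P * g)
  have h2 := neg_two_le_re_trace (P * g)
  rw [fundamentalRep_apply]; nlinarith

/-! ## §3 The torelon floor -/

/-- ★★ **Torelon floor for a non-negative eigenfunction** (`β ≥ 1`, `Ω ≥ 0` bounded measurable with `K_βΩ = λ₀Ω`, any base point `x'+ê₀`):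
`∫ d_{x'+ê₀}·Ω² dU ≥ 4 sin²(1/(2β))·e^{−14}·∫ Ω² dU`. [cite: ReedSimonIV1978, Thm. XIII.43] -/
theorem integral_torelonDev_mul_sq_ge_of_nonneg {β : ℝ} (hβ : 1 ≤ β) {Ω : GaugeConfig 3 L SU2 → ℝ} (hΩm : Measurable Ω) {C : ℝ}
    (hΩb : ∀ U, |Ω U| ≤ C) (hΩnn : ∀ U, 0 ≤ Ω U) (heig : transferApply β Ω = topValue su2Rep L β • Ω) (x' : Site 3 L) :
    4 * Real.sin (1 / (2 * β)) ^ 2 * Real.exp (-14) * ∫ U, Ω U ^ 2 ∂configMeasure SU2 L ≤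
      ∫ U, flowLiftAt (x'.shift 0) 0 (fun u : GaugeConfig 3 1 SU2 => 4 - ((su2Rep (u ((0 : Site 3 1), (0 : Fin 3)))).trace.re) ^ 2) U *
        Ω U ^ 2 ∂configMeasure SU2 L := by
  haveI : SecondCountableTopology SU2 := secondCountableTopology_su2
  have hβ0 : 0 < β := by linarith
  set θ : ℝ := 1 / (2 * β) with hθ
  have hθ0 : 0 < θ := by positivity
  have hθ1 : θ ≤ 1 / 2 := by
    rw [hθ]; exact one_div_le_one_div_of_le (by norm_num) (by linarith)
  -- `sin²θ ≤ cos²θ`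
  have hsin : Real.sin θ ≤ θ := Real.sin_le hθ0.le
  have hsin0 : 0 ≤ Real.sin θ := Real.sin_nonneg_of_nonneg_of_le_pi hθ0.le (by linarith [Real.pi_gt_three])
  have hcos : 1 - θ ^ 2 / 2 ≤ Real.cos θ := Real.one_sub_sq_div_two_le_cos
  have hsc : Real.sin θ ^ 2 ≤ Real.cos θ ^ 2 := by
    have h1 : Real.sin θ ^ 2 ≤ θ ^ 2 := pow_le_pow_left₀ hsin0 hsin 2
    have h2 : θ ^ 2 ≤ 1 / 4 := by nlinarith
    have h3 : 7 / 8 ≤ Real.cos θ := by nlinarith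
    have h4 : (7 / 8 : ℝ) ^ 2 ≤ Real.cos θ ^ 2 := pow_le_pow_left₀ (by norm_num) h3 2
    nlinarith
  set f : GaugeConfig 3 1 SU2 → ℝ := fun u => 4 - ((su2Rep (u ((0 : Site 3 1), (0 : Fin 3)))).trace.re) ^ 2 with hf_def
  set e : Edge 3 L := (x', (0 : Fin 3)) with he
  set x : Site 3 L := x'.shift 0 with hx
  -- the weight `d_x`: physical, `0 ≤ d_x ≤ 4`
  have hdphys : IsPhys (flowLiftAt (L := L) x 0 f) := isPhys_adjLoopAt x
  have hd4 : ∀ U : GaugeConfig 3 L SU2, |flowLiftAt x 0 f U| ≤ 4 := fun U => by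
    rw [flowLiftAt_torelonDev_eq]
    have h1 := re_trace_le_two (lineHolonomy U 0 L x)
    have h2 := neg_two_le_re_trace (lineHolonomy U 0 L x)
    rw [fundamentalRep_apply, abs_le]; constructor <;> nlinarith [sq_nonneg (((lineHolonomy U 0 L x : SU2) : Matrix (Fin 2) (Fin 2) ℂ).trace.re)]
  have hC0 : 0 ≤ C := (abs_nonneg _).trans (hΩb (fun _ => 1))
  -- the integrand `G = d_x Ω²` is bounded measurable
  set G : GaugeConfig 3 L SU2 → ℝ := fun U => flowLiftAt x 0 f U * Ω U ^ 2 with hG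
  have hGm : Measurable G := hdphys.measurable.mul (hΩm.pow_const 2)
  have hGb : ∀ U, |G U| ≤ 4 * C ^ 2 := fun U => by
    rw [hG]; dsimp only; rw [abs_mul, abs_pow]
    exact mul_le_mul (hd4 U) (pow_le_pow_left₀ (abs_nonneg _) (hΩb U) 2) (by positivity) (by norm_num)
  -- Haar invariance under the two shifts
  have hinv : ∀ g : SU2, ∫ U, G (Function.update U e (U e * g)) ∂configMeasure SU2 L = ∫ U, G U ∂configMeasure SU2 L := fun g =>
    integral_configMeasure_comp_update_mul_right e (g := fun _ => g) measurable_const (fun _ _ => rfl) hGm hGb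
  -- pointwise: the two shifted integrands dominate `8 sin²θ e^{-14} Ω²`
  have hν : ∀ s : ℝ, |s| = θ → 14 * Real.sqrt 2 * β * frobNorm (((diagSU2 s : SU2) : Matrix (Fin 2) (Fin 2) ℂ) - 1) ≤ 14 := by
    intro s hs
    have h1 := TwoLattice.Toron.frobNorm_diagSU2_sub_one_le s
    rw [hs] at h1
    have h2 : Real.sqrt 2 * Real.sqrt 2 = 2 := Real.mul_self_sqrt (by norm_num)
    have h3 : 14 * Real.sqrt 2 * β * (Real.sqrt 2 * θ) = 14 := by
      rw [show 14 * Real.sqrt 2 * β * (Real.sqrt 2 * θ) = 14 * (Real.sqrt 2 * Real.sqrt 2) * (β * θ) by ring, h2, hθ]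
      field_simp
    calc 14 * Real.sqrt 2 * β * frobNorm (((diagSU2 s : SU2) : Matrix (Fin 2) (Fin 2) ℂ) - 1)
        ≤ 14 * Real.sqrt 2 * β * (Real.sqrt 2 * θ) := mul_le_mul_of_nonneg_left h1 (by positivity)
      _ = 14 := h3
  have hharn : ∀ s : ℝ, |s| = θ → ∀ U : GaugeConfig 3 L SU2,
      Real.exp (-14) * Ω U ^ 2 ≤ Ω (Function.update U e (U e * diagSU2 s)) ^ 2 := by
    intro s hs U
    have h := vacuum_sq_linkShift_ge hβ0.le hΩm hΩb hΩnn heig e (diagSU2 s) U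
    refine le_trans (mul_le_mul_of_nonneg_right (Real.exp_le_exp.mpr ?_) (sq_nonneg _)) h
    linarith [hν s hs]
  have hpt : ∀ U : GaugeConfig 3 L SU2, 8 * Real.sin θ ^ 2 * Real.exp (-14) * Ω U ^ 2 ≤
      G (Function.update U e (U e * diagSU2 θ)) + G (Function.update U e (U e * diagSU2 (-θ))) := by
    intro U
    rw [hG]; dsimp only
    rw [hx, flowLiftAt_torelonDev_update, flowLiftAt_torelonDev_update]
    have hp := torelonDev_diag_pair_ge (lineHolonomy U 0 L (x'.shift 0)) hsc
    rw [← fundamentalRep_apply (lineHolonomy U 0 L (x'.shift 0)), ← fundamentalRep_apply (diagSU2 θ),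
      ← fundamentalRep_apply (diagSU2 (-θ))] at hp
    have hq1 := torelonDev_mul_nonneg (lineHolonomy U 0 L (x'.shift 0)) (diagSU2 θ)
    have hq2 := torelonDev_mul_nonneg (lineHolonomy U 0 L (x'.shift 0)) (diagSU2 (-θ))
    have hh1 := hharn θ (abs_of_pos hθ0) U
    have hh2 := hharn (-θ) (by rw [abs_neg, abs_of_pos hθ0]) U
    have hΩ2 : 0 ≤ Ω U ^ 2 := sq_nonneg _
    calc 8 * Real.sin θ ^ 2 * Real.exp (-14) * Ω U ^ 2
        ≤ ((4 - ((su2Rep (lineHolonomy U 0 L (x'.shift 0)) * su2Rep (diagSU2 θ)).trace.re) ^ 2) +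
            (4 - ((su2Rep (lineHolonomy U 0 L (x'.shift 0)) * su2Rep (diagSU2 (-θ))).trace.re) ^ 2)) *
            (Real.exp (-14) * Ω U ^ 2) := by
          rw [show 8 * Real.sin θ ^ 2 * Real.exp (-14) * Ω U ^ 2 = (8 * Real.sin θ ^ 2) * (Real.exp (-14) * Ω U ^ 2) by ring]
          exact mul_le_mul_of_nonneg_right hp (by positivity)
      _ ≤ _ := by
          rw [add_mul]
          exact add_le_add (mul_le_mul_of_nonneg_left hh1 hq1) (mul_le_mul_of_nonneg_left hh2 hq2)
  -- integrate
  have hint : ∀ (F : GaugeConfig 3 L SU2 → ℝ), Measurable F → ∀ (C' : ℝ), (∀ U, |F U| ≤ C') → Integrable F (configMeasure SU2 L) :=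
    fun F hF C' hC => ⟨hF.aestronglyMeasurable, HasFiniteIntegral.of_bounded (C := C') (ae_of_all _ fun U => by
      rw [Real.norm_eq_abs]; exact hC U)⟩
  have hGi : ∀ g : SU2, Integrable (fun U => G (Function.update U e (U e * g))) (configMeasure SU2 L) := fun g =>
    hint _ (hGm.comp (measurable_update_mul_right_of_blind e (g := fun _ => g) measurable_const)) _ (fun U => hGb _)
  have hΩ2i : Integrable (fun U => Ω U ^ 2) (configMeasure SU2 L) :=
    hint _ (hΩm.pow_const 2) (C ^ 2) fun U => by rw [abs_pow]; exact pow_le_pow_left₀ (abs_nonneg _) (hΩb U) 2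
  have hsum : ∫ U, 8 * Real.sin θ ^ 2 * Real.exp (-14) * Ω U ^ 2 ∂configMeasure SU2 L ≤
      ∫ U, G (Function.update U e (U e * diagSU2 θ)) + G (Function.update U e (U e * diagSU2 (-θ))) ∂configMeasure SU2 L :=
    integral_mono (hΩ2i.const_mul _) ((hGi _).add (hGi _)) hpt
  rw [integral_const_mul, integral_add (hGi _) (hGi _), hinv, hinv] at hsum
  have hGdef : ∫ U, G U ∂configMeasure SU2 L = ∫ U, flowLiftAt x 0 f U * Ω U ^ 2 ∂configMeasure SU2 L := rfl
  rw [hGdef] at hsum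
  linarith

/-- Numerics of the floor: `e^{−15}/β² ≤ 4 sin²(1/(2β))·e^{−14}` for `β ≥ 1` (`sin x ≥ x − x³/6 ≥ 23x/24` on `(0, ½]`, `e^{−1} ≤ 529/576`).
[folklore] -/
theorem torelonFloor_numeric {β : ℝ} (hβ : 1 ≤ β) :
    Real.exp (-15) / β ^ 2 ≤ 4 * Real.sin (1 / (2 * β)) ^ 2 * Real.exp (-14) := by
  have hβ0 : 0 < β := by linarith
  set x : ℝ := 1 / (2 * β) with hx
  have hx0 : 0 < x := by positivity
  have hx1 : x ≤ 1 / 2 := by rw [hx]; exact one_div_le_one_div_of_le (by norm_num) (by linarith)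
  have hcube := Real.sin_gt_sub_cube hx0
  have hx2 : x ^ 2 ≤ 1 / 4 := by nlinarith
  have hx3 : x ^ 3 ≤ x / 4 := by
    calc x ^ 3 = x * x ^ 2 := by ring
      _ ≤ x * (1 / 4) := mul_le_mul_of_nonneg_left hx2 hx0.le
      _ = x / 4 := by ring
  have hsin : 23 / 24 * x ≤ Real.sin x := by linarith
  have hsin2 : (23 / 24 * x) ^ 2 ≤ Real.sin x ^ 2 := pow_le_pow_left₀ (by positivity) hsin 2
  have hxβ : x * β = 1 / 2 := by rw [hx]; field_simp
  have he1 : Real.exp (-1) ≤ 529 / 576 := by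
    rw [Real.exp_neg, show (529 : ℝ) / 576 = (576 / 529)⁻¹ by norm_num]
    exact inv_anti₀ (by norm_num) (by linarith [Real.exp_one_gt_d9])
  have he15 : Real.exp (-15) = Real.exp (-14) * Real.exp (-1) := by rw [← Real.exp_add]; norm_num
  have he14 : 0 < Real.exp (-14) := Real.exp_pos _
  rw [he15, div_le_iff₀ (by positivity)]
  have hkey : Real.exp (-1) ≤ 4 * Real.sin x ^ 2 * β ^ 2 := by
    have h1 : 4 * (23 / 24 * x) ^ 2 * β ^ 2 = 529 / 576 := by
      rw [show 4 * (23 / 24 * x) ^ 2 * β ^ 2 = 529 / 144 * (x * β) ^ 2 by ring, hxβ]; norm_num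
    nlinarith [hsin2, sq_nonneg β]
  nlinarith [hkey, he14]

/-- ★★★ **TORELON FLOOR OF THE EXACT VACUUM** (`β ≥ 1`; every `L`; every site `x`; every `l2`-normalised physical `Ω` with `K_βΩ = λ₀Ω`,
of either sign): `∫ (4 − (Re tr ρ(P₀(x)))²)·Ω² dU ≥ e^{−15}/β²`.  Perron–Frobenius (`Ω = ±Ω₊` pointwise, ✓`PolyakovLift.rawVacuum_eq_smul_of_gap`)
reduces to `Ω₊ ≥ 0`, then ★★ `integral_torelonDev_mul_sq_ge_of_nonneg` and `torelonFloor_numeric`. [cite: ReedSimonIV1978, Thm. XIII.43]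
[cite: Luscher1983, §2] -/
theorem torelonDev_vacuum_mean_ge {β : ℝ} (hβ : 1 ≤ β) {Ω : GaugeConfig 3 L SU2 → ℝ} (hΩ : IsPhys Ω) (hn : l2 Ω Ω = 1)
    (heig : transferApply β Ω = topValue su2Rep L β • Ω) (x : Site 3 L) :
    Real.exp (-15) / β ^ 2 ≤
      ∫ U, flowLiftAt x 0 (fun u : GaugeConfig 3 1 SU2 => 4 - ((su2Rep (u ((0 : Site 3 1), (0 : Fin 3)))).trace.re) ^ 2) U *
        Ω U ^ 2 ∂configMeasure SU2 L := by
  haveI : SecondCountableTopology SU2 := secondCountableTopology_su2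
  -- Perron–Frobenius: `Ω = a Ω₊` pointwise with `a² = 1`
  obtain ⟨Ωp, θ, cp, hΩp, hcp, hΩpge, hnp, heigp, -, hθ, hgap⟩ := PhysL2.exists_groundState (L := L) β
  have hφΩ := PolyakovLift.rawVacuum_eq_smul_of_gap β hΩ heig hΩp hnp heigp hθ hgap
  set a : ℝ := l2 Ω Ωp with ha
  have hnp' : ∫ U, Ωp U * Ωp U ∂configMeasure SU2 L = 1 := hnp
  have ha2 : a ^ 2 = 1 := by
    have h1 : l2 Ω Ω = a ^ 2 * ∫ U, Ωp U * Ωp U ∂configMeasure SU2 L := by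
      unfold l2; rw [← integral_const_mul]
      refine integral_congr_ae (ae_of_all _ fun U => ?_)
      dsimp only; rw [hφΩ U]; ring
    rw [hn, hnp', mul_one] at h1
    exact h1.symm
  have hsq : ∀ U, Ω U ^ 2 = Ωp U ^ 2 := fun U => by rw [hφΩ U, mul_pow, ha2, one_mul]
  have hΩpnn : ∀ U, 0 ≤ Ωp U := fun U => hcp.le.trans (hΩpge U)
  obtain ⟨Cp, hCp⟩ := hΩp.bounded
  -- base point `x = x'.shift 0`
  set x' : Site 3 L := x - Pi.single (0 : Fin 3) 1 with hx'
  have hxx : x'.shift 0 = x := by rw [hx', Site.shift, sub_add_cancel]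
  have hmain := integral_torelonDev_mul_sq_ge_of_nonneg hβ hΩp.measurable hCp hΩpnn heigp x'
  rw [hxx] at hmain
  have hone : ∫ U, Ωp U ^ 2 ∂configMeasure SU2 L = 1 := by
    rw [← hnp']; exact integral_congr_ae (ae_of_all _ fun U => by dsimp only; ring)
  rw [hone, mul_one] at hmain
  have hnum := torelonFloor_numeric hβ
  calc Real.exp (-15) / β ^ 2 ≤ 4 * Real.sin (1 / (2 * β)) ^ 2 * Real.exp (-14) := hnum
    _ ≤ _ := hmain
    _ = _ := integral_congr_ae (ae_of_all _ fun U => by dsimp only; rw [hsq U])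

/-! ## §4 The log-floor in the letters of ✓`dWeightedPlaquetteMean_of_logFloor` -/

/-- ★★★ **The torelon LOG-FLOOR** — verbatim the hypothesis `hfloor` of ✓`dWeightedPlaquetteMean_of_logFloor`, with `k₀ = 0`, `C₀ = 15 + 2/ε`,
`β₁ = 1`: for `β ≥ 1`, every `L` and every `l2`-normalised physical `Ω` with `K_βΩ = λ₀Ω`, `0 < E[FΩ²]` and `log(1/E[FΩ²]) ≤ (15 + 2/ε)·β^ε·L⁰`
(`E[FΩ²] = E[d_0Ω²] ≥ e^{−15}/β²` by translation invariance ✓`l2_flowLiftAt_mul_vacuum_eq_flowLift` and the torelon floor; `log β ≤ β^ε/ε`).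
[cite: ReedSimonIV1978, Thm. XIII.43] [cite: Luscher1983, §2] -/
theorem torelon_logFloor :
    ∃ k₀ : ℝ, 0 ≤ k₀ ∧ ∀ ε : ℝ, 0 < ε → ∃ C₀ β₁ : ℝ, 0 ≤ C₀ ∧ ∀ β : ℝ, β₁ ≤ β → ∀ (L : ℕ) [NeZero L],
      ∀ Ω : Literature.MathematicalPhysics.QuantumFieldTheory.GaugeConfig 3 L SU2 → ℝ, IsPhys Ω → l2 Ω Ω = 1 →
        transferApply β Ω = topValue su2Rep L β • Ω →
          0 < l2 (fun U => flowLift 0 (fun u : Literature.MathematicalPhysics.QuantumFieldTheory.GaugeConfig 3 1 SU2 =>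
            4 - ((su2Rep (u ((0 : Literature.MathematicalPhysics.QuantumFieldTheory.Site 3 1), (0 : Fin 3)))).trace.re) ^ 2) U * Ω U) Ω ∧
          Real.log (l2 (fun U => flowLift 0 (fun u : Literature.MathematicalPhysics.QuantumFieldTheory.GaugeConfig 3 1 SU2 =>
            4 - ((su2Rep (u ((0 : Literature.MathematicalPhysics.QuantumFieldTheory.Site 3 1), (0 : Fin 3)))).trace.re) ^ 2) U * Ω U) Ω)⁻¹ ≤
            C₀ * β ^ ε * (L : ℝ) ^ k₀ := by
  refine ⟨0, le_rfl, fun ε hε => ⟨15 + 2 / ε, 1, by positivity, fun β hβ L _ Ω hΩ hn heig => ?_⟩⟩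
  haveI : SecondCountableTopology SU2 := secondCountableTopology_su2
  have hβ0 : 0 < β := by linarith
  set f : GaugeConfig 3 1 SU2 → ℝ := fun u => 4 - ((su2Rep (u ((0 : Site 3 1), (0 : Fin 3)))).trace.re) ^ 2 with hf_def
  have hfm : Measurable f := by
    have h1 : Continuous fun u : GaugeConfig 3 1 SU2 => su2Rep (u ((0 : Site 3 1), (0 : Fin 3))) :=
      continuous_su2Rep.comp (continuous_apply _)
    exact (continuous_const.sub ((Complex.continuous_re.comp h1.matrix_trace).pow 2)).measurable
  have hfb : ∀ u, |f u| ≤ 4 := fun u => by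
    rw [hf_def]; dsimp only
    have h1 := re_trace_le_two (u ((0 : Site 3 1), (0 : Fin 3)))
    have h2 := neg_two_le_re_trace (u ((0 : Site 3 1), (0 : Fin 3)))
    rw [fundamentalRep_apply, abs_le]
    constructor <;> nlinarith [sq_nonneg (((u ((0 : Site 3 1), (0 : Fin 3)) : SU2) : Matrix (Fin 2) (Fin 2) ℂ).trace.re)]
  -- `E[FΩ²] = E[d_0 Ω²] ≥ e^{-15}/β²`
  set m : ℝ := l2 (fun U => flowLift 0 f U * Ω U) Ω with hm
  have hm0 : l2 (fun U => flowLiftAt (0 : Site 3 L) 0 f U * Ω U) Ω = m :=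
    l2_flowLiftAt_mul_vacuum_eq_flowLift β hΩ heig hfm hfb (0 : Site 3 L)
  have hm1 : l2 (fun U => flowLiftAt (0 : Site 3 L) 0 f U * Ω U) Ω =
      ∫ U, flowLiftAt (0 : Site 3 L) 0 f U * Ω U ^ 2 ∂configMeasure SU2 L := by
    unfold l2; exact integral_congr_ae (ae_of_all _ fun U => by dsimp only; ring)
  have hfloor := torelonDev_vacuum_mean_ge hβ hΩ hn heig (0 : Site 3 L)
  rw [← hm1, hm0] at hfloor
  have hpos0 : 0 < Real.exp (-15) / β ^ 2 := by positivity
  have hmpos : 0 < m := hpos0.trans_le hfloor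
  refine ⟨hmpos, ?_⟩
  -- `log(1/m) ≤ 15 + 2 log β ≤ (15 + 2/ε) β^ε`
  have hlogm : Real.log m⁻¹ ≤ 15 + 2 * Real.log β := by
    rw [Real.log_inv]
    have h1 : Real.log (Real.exp (-15) / β ^ 2) ≤ Real.log m := Real.log_le_log hpos0 hfloor
    rw [Real.log_div (Real.exp_pos _).ne' (by positivity), Real.log_exp, Real.log_pow] at h1
    push_cast at h1; linarith
  have hlogβ : Real.log β ≤ β ^ ε / ε := Real.log_le_rpow_div hβ0.le hε
  have hβε : 1 ≤ β ^ ε := Real.one_le_rpow hβ hε.le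
  have hL0 : ((L : ℕ) : ℝ) ^ (0 : ℝ) = 1 := Real.rpow_zero _
  rw [hL0, mul_one]
  have h15 : (15 : ℝ) ≤ 15 * β ^ ε := by nlinarith
  calc Real.log m⁻¹ ≤ 15 + 2 * Real.log β := hlogm
    _ ≤ 15 * β ^ ε + 2 * (β ^ ε / ε) := by linarith
    _ = (15 + 2 / ε) * β ^ ε := by ring

end Summit.QuantumFields.YangMills.Theorems.TransportFieldFano

end
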